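import Summits.Ventures.HodgeRepro2.HodgePeriodHeckeEigen

/-!
# HodgePeriodParitySelection — the Atkin–Lehner PARITY SELECTION RULE for the (N)-period: only the component of
the vertex form with the same Atkin–Lehner sign as the partner contributes (p2 annex row 165)

Cell pub-hodge-repro2, Tier 5 kernel annex (seat p2, Shimura-data / Hecke side). Proof lane (no new definition).
§8(d): uses an L-value-free non-vanishing device: NO.

For a self-adjoint Hecke operator (`T_δ = T_{δ⁻¹}`, e.g. `δ⁻¹ ∈ SδS` or `δ² = 1`) and a `T_δ`-eigenform `g` of
REAL eigenvalue `r` (row 162: the period pairing against `g` is a `T_δ`-eigenfunctional of eigenvalue `r`):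
* `setIntegral_hodgeWedge_add_heckeForms` / `setIntegral_hodgeWedge_sub_heckeForms` — the period of `f ± T_δ f`
  against `g` is `(1 ± r)` times the period of `f` (linearity of the Hodge period in `f` through the Petersson
  bridge + row 162).
* `setIntegral_hodgeWedge_sub_smul_heckeForms_eq_zero` — for `r = ±1` (an Atkin–Lehner sign, row 148): the
  OPPOSITE-parity component `f − r T_δ f` of the vertex form pairs to ZERO with `g`, and
  `setIntegral_hodgeWedge_eq_half_add_smul_heckeForms` — the period of `f` is half the period of the same-parity
  component `f + r T_δ f`: `∫_D ω_f ∧ conj ω_g = ½ ∫_D ω_{f + r T_δ f} ∧ conj ω_g`.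
  Consequence (`setIntegral_hodgeWedge_add_smul_heckeForms_ne_zero`): the (N)-period `∫_D ω_f ∧ conj ω_g ≠ 0`
  forces the same-parity component `f + r T_δ f` of the vertex form to be non-zero.

No `sorry`; `#print axioms` ⊆ {propext, Classical.choice, Quot.sound}.
-/

namespace Summit.Ventures.HodgeRepro2.ShimuraData

variable {K : Type*} [Field K] [NumberField K] [NumberField.IsCMField K]
  {τ₁ : K →+* ℂ} {H : Matrix (Fin 3) (Fin 3) K} {Q : Matrix (Fin 3) (Fin 3) ℂ}
  (hQ : IsFrame K τ₁ H Q) (S : Subgroup (GL (Fin 3) K)) (hS : (S : Set (GL (Fin 3) K)) ⊆ unitaryGroup K H)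
  [CompactSpace (ballQuotient hQ S hS)] {D : Set ball₂} (hD : IsBallFundamentalDomain hQ S hS D)
  (hDm : MeasurableSet D)
  (inst : ∀ δ : unitaryGroup K H, Fintype (S ⧸ (heckeSubgroup S (δ : GL (Fin 3) K)).subgroupOf S))

include hDm in
/-- The Hodge period is additive in the first form (through the Petersson bridge). -/
theorem setIntegral_hodgeWedge_add_left (f f' g : PeterssonForms hQ S hS 3 hD) :
    ∫ x in (Subtype.val '' D),
        hodgeWedge (PeterssonForms.toForm hQ S hS 3 hD (f + f') : (Fin 2 → ℂ) → ℂ)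
          (PeterssonForms.toForm hQ S hS 3 hD g : (Fin 2 → ℂ) → ℂ) x =
      (∫ x in (Subtype.val '' D),
        hodgeWedge (PeterssonForms.toForm hQ S hS 3 hD f : (Fin 2 → ℂ) → ℂ)
          (PeterssonForms.toForm hQ S hS 3 hD g : (Fin 2 → ℂ) → ℂ) x) +
      ∫ x in (Subtype.val '' D),
        hodgeWedge (PeterssonForms.toForm hQ S hS 3 hD f' : (Fin 2 → ℂ) → ℂ)
          (PeterssonForms.toForm hQ S hS 3 hD g : (Fin 2 → ℂ) → ℂ) x := by
  rw [setIntegral_hodgeWedge_eq_inner_mk hQ S hS hD hDm, setIntegral_hodgeWedge_eq_inner_mk hQ S hS hD hDm,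
    setIntegral_hodgeWedge_eq_inner_mk hQ S hS hD hDm, SeparationQuotient.mk_add, inner_add_right, mul_add]

include hDm in
/-- The Hodge period is homogeneous in the first form. -/
theorem setIntegral_hodgeWedge_smul_left (c : ℂ) (f g : PeterssonForms hQ S hS 3 hD) :
    ∫ x in (Subtype.val '' D),
        hodgeWedge (PeterssonForms.toForm hQ S hS 3 hD (c • f) : (Fin 2 → ℂ) → ℂ)
          (PeterssonForms.toForm hQ S hS 3 hD g : (Fin 2 → ℂ) → ℂ) x =
      c * ∫ x in (Subtype.val '' D),
        hodgeWedge (PeterssonForms.toForm hQ S hS 3 hD f : (Fin 2 → ℂ) → ℂ)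
          (PeterssonForms.toForm hQ S hS 3 hD g : (Fin 2 → ℂ) → ℂ) x := by
  rw [setIntegral_hodgeWedge_eq_inner_mk hQ S hS hD hDm, setIntegral_hodgeWedge_eq_inner_mk hQ S hS hD hDm,
    SeparationQuotient.mk_smul, inner_smul_right]
  ring

include hDm in
/-- The Hodge period respects subtraction in the first form. -/
theorem setIntegral_hodgeWedge_sub_left (f f' g : PeterssonForms hQ S hS 3 hD) :
    ∫ x in (Subtype.val '' D),
        hodgeWedge (PeterssonForms.toForm hQ S hS 3 hD (f - f') : (Fin 2 → ℂ) → ℂ)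
          (PeterssonForms.toForm hQ S hS 3 hD g : (Fin 2 → ℂ) → ℂ) x =
      (∫ x in (Subtype.val '' D),
        hodgeWedge (PeterssonForms.toForm hQ S hS 3 hD f : (Fin 2 → ℂ) → ℂ)
          (PeterssonForms.toForm hQ S hS 3 hD g : (Fin 2 → ℂ) → ℂ) x) -
      ∫ x in (Subtype.val '' D),
        hodgeWedge (PeterssonForms.toForm hQ S hS 3 hD f' : (Fin 2 → ℂ) → ℂ)
          (PeterssonForms.toForm hQ S hS 3 hD g : (Fin 2 → ℂ) → ℂ) x := by
  rw [setIntegral_hodgeWedge_eq_inner_mk hQ S hS hD hDm, setIntegral_hodgeWedge_eq_inner_mk hQ S hS hD hDm,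
    setIntegral_hodgeWedge_eq_inner_mk hQ S hS hD hDm, SeparationQuotient.mk_sub, inner_sub_right, mul_sub]

variable {δ : unitaryGroup K H}
  (hself : heckeFamilyOf hQ S hS 3 hD hDm inst δ = heckeFamilyOf hQ S hS 3 hD hDm inst δ⁻¹)
  {g : PeterssonForms hQ S hS 3 hD} {r : ℝ}
  (hg : heckeFamilyOf hQ S hS 3 hD hDm inst δ (SeparationQuotient.mk g) = (r : ℂ) • SeparationQuotient.mk g)

include hself hg in
/-- The period of `f + r T_δ f` against the eigenform `g` is `(1 + r²)` times the period of `f`. -/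
theorem setIntegral_hodgeWedge_add_smul_heckeForms (f : PeterssonForms hQ S hS 3 hD) :
    ∫ x in (Subtype.val '' D),
        hodgeWedge (PeterssonForms.toForm hQ S hS 3 hD
          (f + (r : ℂ) • @heckeForms _ _ _ _ _ _ _ hQ S hS _ _ 3 hD _ δ.2 (inst δ) f) : (Fin 2 → ℂ) → ℂ)
          (PeterssonForms.toForm hQ S hS 3 hD g : (Fin 2 → ℂ) → ℂ) x =
      (1 + (r : ℂ) ^ 2) * ∫ x in (Subtype.val '' D),
        hodgeWedge (PeterssonForms.toForm hQ S hS 3 hD f : (Fin 2 → ℂ) → ℂ)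
          (PeterssonForms.toForm hQ S hS 3 hD g : (Fin 2 → ℂ) → ℂ) x := by
  rw [setIntegral_hodgeWedge_add_left hQ S hS hD hDm, setIntegral_hodgeWedge_smul_left hQ S hS hD hDm,
    setIntegral_hodgeWedge_heckeForms_eigen hQ S hS hD hDm inst hself hg f]
  ring

include hself hg in
/-- The period of `f − r T_δ f` against the eigenform `g` is `(1 − r²)` times the period of `f`. -/
theorem setIntegral_hodgeWedge_sub_smul_heckeForms (f : PeterssonForms hQ S hS 3 hD) :
    ∫ x in (Subtype.val '' D),
        hodgeWedge (PeterssonForms.toForm hQ S hS 3 hD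
          (f - (r : ℂ) • @heckeForms _ _ _ _ _ _ _ hQ S hS _ _ 3 hD _ δ.2 (inst δ) f) : (Fin 2 → ℂ) → ℂ)
          (PeterssonForms.toForm hQ S hS 3 hD g : (Fin 2 → ℂ) → ℂ) x =
      (1 - (r : ℂ) ^ 2) * ∫ x in (Subtype.val '' D),
        hodgeWedge (PeterssonForms.toForm hQ S hS 3 hD f : (Fin 2 → ℂ) → ℂ)
          (PeterssonForms.toForm hQ S hS 3 hD g : (Fin 2 → ℂ) → ℂ) x := by
  rw [setIntegral_hodgeWedge_sub_left hQ S hS hD hDm, setIntegral_hodgeWedge_smul_left hQ S hS hD hDm,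
    setIntegral_hodgeWedge_heckeForms_eigen hQ S hS hD hDm inst hself hg f]
  ring

include hself hg in
/-- PARITY SELECTION: for an Atkin–Lehner sign `r = ±1`, the opposite-parity component `f − r T_δ f` of the
vertex form pairs to zero with `g`. -/
theorem setIntegral_hodgeWedge_sub_smul_heckeForms_eq_zero (hr : r = 1 ∨ r = -1)
    (f : PeterssonForms hQ S hS 3 hD) :
    ∫ x in (Subtype.val '' D),
        hodgeWedge (PeterssonForms.toForm hQ S hS 3 hD
          (f - (r : ℂ) • @heckeForms _ _ _ _ _ _ _ hQ S hS _ _ 3 hD _ δ.2 (inst δ) f) : (Fin 2 → ℂ) → ℂ)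
          (PeterssonForms.toForm hQ S hS 3 hD g : (Fin 2 → ℂ) → ℂ) x = 0 := by
  rw [setIntegral_hodgeWedge_sub_smul_heckeForms hQ S hS hD hDm inst hself hg f]
  have : (1 - (r : ℂ) ^ 2) = 0 := by rcases hr with h | h <;> rw [h] <;> norm_num
  rw [this, zero_mul]

include hself hg in
/-- PARITY SELECTION: for an Atkin–Lehner sign `r = ±1`, the period of `f` is half the period of its
same-parity component `f + r T_δ f`. -/
theorem setIntegral_hodgeWedge_eq_half_add_smul_heckeForms (hr : r = 1 ∨ r = -1)
    (f : PeterssonForms hQ S hS 3 hD) :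
    ∫ x in (Subtype.val '' D),
        hodgeWedge (PeterssonForms.toForm hQ S hS 3 hD f : (Fin 2 → ℂ) → ℂ)
          (PeterssonForms.toForm hQ S hS 3 hD g : (Fin 2 → ℂ) → ℂ) x =
      (2 : ℂ)⁻¹ * ∫ x in (Subtype.val '' D),
        hodgeWedge (PeterssonForms.toForm hQ S hS 3 hD
          (f + (r : ℂ) • @heckeForms _ _ _ _ _ _ _ hQ S hS _ _ 3 hD _ δ.2 (inst δ) f) : (Fin 2 → ℂ) → ℂ)
          (PeterssonForms.toForm hQ S hS 3 hD g : (Fin 2 → ℂ) → ℂ) x := by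
  rw [setIntegral_hodgeWedge_add_smul_heckeForms hQ S hS hD hDm inst hself hg f]
  have : (1 + (r : ℂ) ^ 2) = 2 := by rcases hr with h | h <;> rw [h] <;> norm_num
  rw [this]
  ring

include hself hg in
/-- A non-zero (N)-period forces the same-parity component `f + r T_δ f` of the vertex form to be non-zero. -/
theorem add_smul_heckeForms_ne_zero_of_setIntegral_hodgeWedge_ne_zero (hr : r = 1 ∨ r = -1)
    {f : PeterssonForms hQ S hS 3 hD}
    (h : ∫ x in (Subtype.val '' D),
        hodgeWedge (PeterssonForms.toForm hQ S hS 3 hD f : (Fin 2 → ℂ) → ℂ)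
          (PeterssonForms.toForm hQ S hS 3 hD g : (Fin 2 → ℂ) → ℂ) x ≠ 0) :
    SeparationQuotient.mk (f + (r : ℂ) • @heckeForms _ _ _ _ _ _ _ hQ S hS _ _ 3 hD _ δ.2 (inst δ) f) ≠ 0 := by
  intro h0
  apply h
  rw [setIntegral_hodgeWedge_eq_half_add_smul_heckeForms hQ S hS hD hDm inst hself hg hr f,
    setIntegral_hodgeWedge_eq_inner_mk hQ S hS hD hDm, h0, inner_zero_right, mul_zero, mul_zero]

end Summit.Ventures.HodgeRepro2.ShimuraData
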